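import Summits.BirchSwinnertonDyer.BirchSwinnertonDyer.Theorems.KolyvaginDepthDoorDepthTableRowKitNoTwist
import Summits.BirchSwinnertonDyer.BirchSwinnertonDyer.Theorems.KolyvaginDepthDoorDepthTableRowsOfPrint4
import Summits.BirchSwinnertonDyer.BirchSwinnertonDyer.Theorems.KolyvaginDepthDoorDepthTableRowsOfPrint5
import HarnessLib

/-!
# Route `KolyvaginDepthDoor` — DEPTH-TABLE rows `707a1` `(5, -19, 179)`, `794a1` `(5, -23, 89)`, `817a1` `(5, -8, 239)`, `997b1` `(5, -52, 199)`
# without Kolyvagin's structure theorem AND WITHOUT A POINT ON THE TWIST (crux `KolyvaginDepthSupply`,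
# stmt-BirchSwinnertonDyer-21765) — part 3 of 4

Helper file (`--supports stmt-BirchSwinnertonDyer-21765 --as helper`); it closes nothing and BSD is
not proved by it.

g5's rows `C<label>.depthRow_<p>_neg<D>_<ℓ>_of_print` (files `…DepthTableRowsOfPrint*`) read the row off
the kit `depthRow_of_print_of_intModel_certificate`, which needs ONE rational point of infinite order on
the twist `E^{(d_K)}` (`1 ≤ rank`, a per-row datum the tree does not hold). This file re-issues the
same rows over the twist-free kit `depthRow_noTwist_of_print_of_intModel_certificate` (file
`…DepthTableRowKitNoTwist`; engine: Kolyvagin's eigen-bound `#Sel(E/K)_p^+ ≤ p²` read over `ℚ`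
through the injective restriction `Sel_p(E/ℚ) ↪ Sel_p(E/K)^+`, Literature `SelmerTorsionRestriction`,
PROVED): each row `C<label>.depthRow_<p>_neg<D>_<ℓ>_noTwist` has the hypotheses of its `_of_print`
twin MINUS the twist point, and concludes `corank_{ℤ_p} Ш(E)[p^∞] = 0`, `rank_ℤ E(ℚ) = 2`,
`rank_ℤ E^{(D)}(ℚ) ≤ 1`, `E(ℚ)[p] = 0`, `Ш(E/ℚ)[p] = 0`, `#Sel^(p)(E/ℚ) = p²`. The per-curve side
conditions (`hasSurjectiveModNGaloisRep_pow_<p>`, `not_hasCM`, `heegner_neg<D>`, `card_<ℓ>`,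
`two_le_rank` / `two_le_mordellWeilRank`, `intModel`) are the kernel theorems already landed with the
`_of_print` rows and the depth table (`…DepthTableRows*`, `KernelCerts*`).

Remaining inputs per row, honestly: the five named McCallum/Gross leaves (S/M each), a COMPATIBLE
system of Kolyvagin–Heegner data (existence = CM theory), and the BIT `c_1(ℓ) ≠ 0` (the
Jetchev–Lauter–Stein computation `P(ℓ) ∉ pE(K[ℓ])`, not run in the tree). NO twist datum, NO `p ≥ 5`,
NO Kolyvagin Thm. 4. Per-curve; BSD is not proved by it.
-/

set_option linter.dupNamespace false

noncomputable section

open scoped Classical NumberField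

namespace Summit.BirchSwinnertonDyer.BirchSwinnertonDyer.Theorems.KolyvaginDepthDoor

open Literature.NumberTheory.EllipticCurves Literature.NumberTheory.EllipticCurves.ModularForms
  Literature.NumberTheory.EllipticCurves.McCallum1991 WeierstrassCurve
open Summit.BirchSwinnertonDyer.BirchSwinnertonDyer.Rank2Observatory
open Summit.BirchSwinnertonDyer.BirchSwinnertonDyer.Rank1Residual

namespace C707a1

/-- **DEPTH-TABLE ROW `707a1`, `(p, d_K, ℓ) = (5, -19, 179)`, without Kolyvagin's structure
theorem AND WITHOUT A POINT ON THE TWIST.** For `E = 707a1`, ANY imaginary quadratic `K` with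
`d_K = -19`, any frame `(Dt, β, ι)` and any COMPATIBLE system `d n` of Kolyvagin–Heegner data over it
(`hσ`, `hS₁`, `hS₂`, `hemb`), granted the five named leaves (Gross Prop. 5.4 (2); McCallum Lemma 4.3,
Prop. 4.4, Lemma 5.3, Prop. 2.2): IF the first derived class at the Kolyvagin prime `179` does not
vanish, `(d 179).kolyvaginClass _ 1 ≠ 0` (the row's bit), THEN `corank_{ℤ_5} Ш(E)[5^∞] = 0`,
`rank_ℤ E(ℚ) = 2`, `rank_ℤ E^{(-19)}(ℚ) ≤ 1`, `E(ℚ)[5] = 0`, `Ш(E/ℚ)[5] = 0` and `#Sel^(5)(E/ℚ) = 5²`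
— the twin of `C707a1.depthRow_5_neg19_179_of_print` with its hypothesis `1 ≤ rank E^{(-19)}(ℚ)` DELETED
(kit `depthRow_noTwist_of_print_of_intModel_certificate`: Kolyvagin's eigen-bound read over `ℚ` through
`Sel_5(E/ℚ) ↪ Sel_5(E/K)^+`). Every side condition is a kernel theorem of the tree. CONDITIONAL on the
five facts and the bit; per-curve; BSD is not proved by it. [cite: Kolyvagin1991MathAnn, Thm. 2.3]
[cite: McCallumLMS1991, §§2–5] [cite: GrossLMS1991, §5 (5.1)]
[cite: JetchevLauterStein2009, §3.6 (arXiv:0707.0032)] -/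
theorem depthRow_5_neg19_179_noTwist
    (h54 : sign_conjAct_kolyvaginClass) (h43 : lemma43_kolyvaginClass_mem_selmerLocalKer)
    (h44 : prop44_localOrder_kolyvaginClass_mul_eq) (h53 : lemma53_selmer_eigen_dependent_at)
    (h22 : prop22_reciprocity_eigen_finset)
    (K : Type) [Field K] [NumberField K] (hK : IsImaginaryQuadratic K)
    (hD : NumberField.discr K = -19) :
    haveI := isElliptic_c707a1;
    haveI := isGloballyMinimal_c707a1;
    haveI : NeZero (((⟨0, 1, 1, -12, 12⟩ : WeierstrassCurve ℤ).map (Int.castRingHom ℚ)).conductorNorm ℤ) :=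
      neZero_conductorNorm_of_isElliptic _;
    ∀ (Dt : ModularParametrizationData ((⟨0, 1, 1, -12, 12⟩ : WeierstrassCurve ℤ).map (Int.castRingHom ℚ))
        (((⟨0, 1, 1, -12, 12⟩ : WeierstrassCurve ℤ).map (Int.castRingHom ℚ)).conductorNorm ℤ)) (β : ℤ)
      (ι : K →+* ℂ) (d : ∀ m : ℕ, KolyvaginHeegnerData Dt β ι m),
    (∀ (m l : ℕ), ∀ l' ∈ m.primeFactors, ∀ (x : ringClassField K ι m)
      (x' : ringClassField K ι (m * l)),
      (x : ℂ) = x' → (((d (m * l)).σ l' x' : ringClassField K ι (m * l)) : ℂ) = ((d m).σ l' x : ℂ)) →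
    (∀ (m l : ℕ), ∀ s ∈ (d m).S, ∃ s' ∈ (d (m * l)).S, ∀ (x : ringClassField K ι m)
      (x' : ringClassField K ι (m * l)),
      (x : ℂ) = x' → ((s' x' : ringClassField K ι (m * l)) : ℂ) = (s x : ℂ)) →
    (∀ (m l : ℕ), ∀ s' ∈ (d (m * l)).S, ∃ s ∈ (d m).S, ∀ (x : ringClassField K ι m)
      (x' : ringClassField K ι (m * l)),
      (x : ℂ) = x' → ((s' x' : ringClassField K ι (m * l)) : ℂ) = (s x : ℂ)) →
    (∀ (m l : ℕ) (x : ringClassField K ι m) (x' : ringClassField K ι (m * l)),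
      (x : ℂ) = x' → (d (m * l)).emb x' = (d m).emb x) →
    (d 179).kolyvaginClass (p := 5) (by norm_num) 1 ≠ 0 →
    ((⟨0, 1, 1, -12, 12⟩ : WeierstrassCurve ℤ).map (Int.castRingHom ℚ)).shaCorank 5 = 0 ∧
      ((⟨0, 1, 1, -12, 12⟩ : WeierstrassCurve ℤ).map (Int.castRingHom ℚ)).mordellWeilRank = 2 ∧
      (((⟨0, 1, 1, -12, 12⟩ : WeierstrassCurve ℤ).map (Int.castRingHom ℚ)).quadraticTwist
        ((-19 : ℤ) : ℚ)).mordellWeilRank ≤ 1 ∧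
      (∀ P : ((⟨0, 1, 1, -12, 12⟩ : WeierstrassCurve ℤ).map (Int.castRingHom ℚ)).toAffine.Point,
        5 • P = 0 → P = 0) ∧
      (∀ x ∈ ((⟨0, 1, 1, -12, 12⟩ : WeierstrassCurve ℤ).map (Int.castRingHom ℚ)).sha, 5 • x = 0 → x = 0) ∧
      Nat.card ↥(selmerGroup ((⟨0, 1, 1, -12, 12⟩ : WeierstrassCurve ℤ).map (Int.castRingHom ℚ))
        ((5 : ℕ) : ℤ)) = 5 ^ 2 := by
  haveI := isElliptic_c707a1
  haveI := isGloballyMinimal_c707a1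
  haveI : NeZero (((⟨0, 1, 1, -12, 12⟩ : WeierstrassCurve ℤ).map (Int.castRingHom ℚ)).conductorNorm ℤ) :=
    neZero_conductorNorm_of_isElliptic _
  intro Dt β ι d hσ hS₁ hS₂ hemb hne
  haveI := Fact.mk (by norm_num : Nat.Prime 5)
  exact depthRow_noTwist_of_print_of_intModel_certificate intModel h54 h43 h44 h53 h22 not_hasCM
    KernelCerts002.C707a1.two_le_rank 5 (by norm_num) hasSurjectiveModNGaloisRep_pow_5 K hK hD
    (by norm_num) (by norm_num) heegner_neg19 179 (by norm_num) (by norm_num) (by decide +kernel)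
    (by norm_num) (by norm_num) (by norm_num) (by norm_num) (n := 200) card_179 (by norm_num) Dt β ι
    d hσ hS₁ hS₂ hemb hne

end C707a1

namespace C794a1

/-- **DEPTH-TABLE ROW `794a1`, `(p, d_K, ℓ) = (5, -23, 89)`, without Kolyvagin's structure
theorem AND WITHOUT A POINT ON THE TWIST.** For `E = 794a1`, ANY imaginary quadratic `K` with
`d_K = -23`, any frame `(Dt, β, ι)` and any COMPATIBLE system `d n` of Kolyvagin–Heegner data over it
(`hσ`, `hS₁`, `hS₂`, `hemb`), granted the five named leaves (Gross Prop. 5.4 (2); McCallum Lemma 4.3,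
Prop. 4.4, Lemma 5.3, Prop. 2.2): IF the first derived class at the Kolyvagin prime `89` does not
vanish, `(d 89).kolyvaginClass _ 1 ≠ 0` (the row's bit), THEN `corank_{ℤ_5} Ш(E)[5^∞] = 0`,
`rank_ℤ E(ℚ) = 2`, `rank_ℤ E^{(-23)}(ℚ) ≤ 1`, `E(ℚ)[5] = 0`, `Ш(E/ℚ)[5] = 0` and `#Sel^(5)(E/ℚ) = 5²`
— the twin of `C794a1.depthRow_5_neg23_89_of_print` with its hypothesis `1 ≤ rank E^{(-23)}(ℚ)` DELETED
(kit `depthRow_noTwist_of_print_of_intModel_certificate`: Kolyvagin's eigen-bound read over `ℚ` through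
`Sel_5(E/ℚ) ↪ Sel_5(E/K)^+`). Every side condition is a kernel theorem of the tree. CONDITIONAL on the
five facts and the bit; per-curve; BSD is not proved by it. [cite: Kolyvagin1991MathAnn, Thm. 2.3]
[cite: McCallumLMS1991, §§2–5] [cite: GrossLMS1991, §5 (5.1)]
[cite: JetchevLauterStein2009, §3.6 (arXiv:0707.0032)] -/
theorem depthRow_5_neg23_89_noTwist
    (h54 : sign_conjAct_kolyvaginClass) (h43 : lemma43_kolyvaginClass_mem_selmerLocalKer)
    (h44 : prop44_localOrder_kolyvaginClass_mul_eq) (h53 : lemma53_selmer_eigen_dependent_at)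
    (h22 : prop22_reciprocity_eigen_finset)
    (K : Type) [Field K] [NumberField K] (hK : IsImaginaryQuadratic K)
    (hD : NumberField.discr K = -23) :
    haveI := isElliptic_c794a1;
    haveI := isGloballyMinimal_c794a1;
    haveI : NeZero (((⟨1, 0, 1, -3, 2⟩ : WeierstrassCurve ℤ).map (Int.castRingHom ℚ)).conductorNorm ℤ) :=
      neZero_conductorNorm_of_isElliptic _;
    ∀ (Dt : ModularParametrizationData ((⟨1, 0, 1, -3, 2⟩ : WeierstrassCurve ℤ).map (Int.castRingHom ℚ))
        (((⟨1, 0, 1, -3, 2⟩ : WeierstrassCurve ℤ).map (Int.castRingHom ℚ)).conductorNorm ℤ)) (β : ℤ)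
      (ι : K →+* ℂ) (d : ∀ m : ℕ, KolyvaginHeegnerData Dt β ι m),
    (∀ (m l : ℕ), ∀ l' ∈ m.primeFactors, ∀ (x : ringClassField K ι m)
      (x' : ringClassField K ι (m * l)),
      (x : ℂ) = x' → (((d (m * l)).σ l' x' : ringClassField K ι (m * l)) : ℂ) = ((d m).σ l' x : ℂ)) →
    (∀ (m l : ℕ), ∀ s ∈ (d m).S, ∃ s' ∈ (d (m * l)).S, ∀ (x : ringClassField K ι m)
      (x' : ringClassField K ι (m * l)),
      (x : ℂ) = x' → ((s' x' : ringClassField K ι (m * l)) : ℂ) = (s x : ℂ)) →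
    (∀ (m l : ℕ), ∀ s' ∈ (d (m * l)).S, ∃ s ∈ (d m).S, ∀ (x : ringClassField K ι m)
      (x' : ringClassField K ι (m * l)),
      (x : ℂ) = x' → ((s' x' : ringClassField K ι (m * l)) : ℂ) = (s x : ℂ)) →
    (∀ (m l : ℕ) (x : ringClassField K ι m) (x' : ringClassField K ι (m * l)),
      (x : ℂ) = x' → (d (m * l)).emb x' = (d m).emb x) →
    (d 89).kolyvaginClass (p := 5) (by norm_num) 1 ≠ 0 →
    ((⟨1, 0, 1, -3, 2⟩ : WeierstrassCurve ℤ).map (Int.castRingHom ℚ)).shaCorank 5 = 0 ∧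
      ((⟨1, 0, 1, -3, 2⟩ : WeierstrassCurve ℤ).map (Int.castRingHom ℚ)).mordellWeilRank = 2 ∧
      (((⟨1, 0, 1, -3, 2⟩ : WeierstrassCurve ℤ).map (Int.castRingHom ℚ)).quadraticTwist
        ((-23 : ℤ) : ℚ)).mordellWeilRank ≤ 1 ∧
      (∀ P : ((⟨1, 0, 1, -3, 2⟩ : WeierstrassCurve ℤ).map (Int.castRingHom ℚ)).toAffine.Point,
        5 • P = 0 → P = 0) ∧
      (∀ x ∈ ((⟨1, 0, 1, -3, 2⟩ : WeierstrassCurve ℤ).map (Int.castRingHom ℚ)).sha, 5 • x = 0 → x = 0) ∧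
      Nat.card ↥(selmerGroup ((⟨1, 0, 1, -3, 2⟩ : WeierstrassCurve ℤ).map (Int.castRingHom ℚ))
        ((5 : ℕ) : ℤ)) = 5 ^ 2 := by
  haveI := isElliptic_c794a1
  haveI := isGloballyMinimal_c794a1
  haveI : NeZero (((⟨1, 0, 1, -3, 2⟩ : WeierstrassCurve ℤ).map (Int.castRingHom ℚ)).conductorNorm ℤ) :=
    neZero_conductorNorm_of_isElliptic _
  intro Dt β ι d hσ hS₁ hS₂ hemb hne
  haveI := Fact.mk (by norm_num : Nat.Prime 5)
  exact depthRow_noTwist_of_print_of_intModel_certificate intModel h54 h43 h44 h53 h22 not_hasCM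
    KernelCerts002.C794a1.two_le_rank 5 (by norm_num) hasSurjectiveModNGaloisRep_pow_5 K hK hD
    (by norm_num) (by norm_num) heegner_neg23 89 (by norm_num) (by norm_num) (by decide +kernel)
    (by norm_num) (by norm_num) (by norm_num) (by norm_num) (n := 90) card_89 (by norm_num) Dt β ι
    d hσ hS₁ hS₂ hemb hne

end C794a1

namespace C817a1

/-- **DEPTH-TABLE ROW `817a1`, `(p, d_K, ℓ) = (5, -8, 239)`, without Kolyvagin's structure
theorem AND WITHOUT A POINT ON THE TWIST.** For `E = 817a1`, ANY imaginary quadratic `K` with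
`d_K = -8`, any frame `(Dt, β, ι)` and any COMPATIBLE system `d n` of Kolyvagin–Heegner data over it
(`hσ`, `hS₁`, `hS₂`, `hemb`), granted the five named leaves (Gross Prop. 5.4 (2); McCallum Lemma 4.3,
Prop. 4.4, Lemma 5.3, Prop. 2.2): IF the first derived class at the Kolyvagin prime `239` does not
vanish, `(d 239).kolyvaginClass _ 1 ≠ 0` (the row's bit), THEN `corank_{ℤ_5} Ш(E)[5^∞] = 0`,
`rank_ℤ E(ℚ) = 2`, `rank_ℤ E^{(-8)}(ℚ) ≤ 1`, `E(ℚ)[5] = 0`, `Ш(E/ℚ)[5] = 0` and `#Sel^(5)(E/ℚ) = 5²`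
— the twin of `C817a1.depthRow_5_neg8_239_of_print` with its hypothesis `1 ≤ rank E^{(-8)}(ℚ)` DELETED
(kit `depthRow_noTwist_of_print_of_intModel_certificate`: Kolyvagin's eigen-bound read over `ℚ` through
`Sel_5(E/ℚ) ↪ Sel_5(E/K)^+`). Every side condition is a kernel theorem of the tree. CONDITIONAL on the
five facts and the bit; per-curve; BSD is not proved by it. [cite: Kolyvagin1991MathAnn, Thm. 2.3]
[cite: McCallumLMS1991, §§2–5] [cite: GrossLMS1991, §5 (5.1)]
[cite: JetchevLauterStein2009, §3.6 (arXiv:0707.0032)] -/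
theorem depthRow_5_neg8_239_noTwist
    (h54 : sign_conjAct_kolyvaginClass) (h43 : lemma43_kolyvaginClass_mem_selmerLocalKer)
    (h44 : prop44_localOrder_kolyvaginClass_mul_eq) (h53 : lemma53_selmer_eigen_dependent_at)
    (h22 : prop22_reciprocity_eigen_finset)
    (K : Type) [Field K] [NumberField K] (hK : IsImaginaryQuadratic K)
    (hD : NumberField.discr K = -8) :
    haveI := isElliptic_c817a1;
    haveI := isGloballyMinimal_c817a1;
    haveI : NeZero (((⟨0, 1, 1, 1, 6⟩ : WeierstrassCurve ℤ).map (Int.castRingHom ℚ)).conductorNorm ℤ) :=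
      neZero_conductorNorm_of_isElliptic _;
    ∀ (Dt : ModularParametrizationData ((⟨0, 1, 1, 1, 6⟩ : WeierstrassCurve ℤ).map (Int.castRingHom ℚ))
        (((⟨0, 1, 1, 1, 6⟩ : WeierstrassCurve ℤ).map (Int.castRingHom ℚ)).conductorNorm ℤ)) (β : ℤ)
      (ι : K →+* ℂ) (d : ∀ m : ℕ, KolyvaginHeegnerData Dt β ι m),
    (∀ (m l : ℕ), ∀ l' ∈ m.primeFactors, ∀ (x : ringClassField K ι m)
      (x' : ringClassField K ι (m * l)),
      (x : ℂ) = x' → (((d (m * l)).σ l' x' : ringClassField K ι (m * l)) : ℂ) = ((d m).σ l' x : ℂ)) →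
    (∀ (m l : ℕ), ∀ s ∈ (d m).S, ∃ s' ∈ (d (m * l)).S, ∀ (x : ringClassField K ι m)
      (x' : ringClassField K ι (m * l)),
      (x : ℂ) = x' → ((s' x' : ringClassField K ι (m * l)) : ℂ) = (s x : ℂ)) →
    (∀ (m l : ℕ), ∀ s' ∈ (d (m * l)).S, ∃ s ∈ (d m).S, ∀ (x : ringClassField K ι m)
      (x' : ringClassField K ι (m * l)),
      (x : ℂ) = x' → ((s' x' : ringClassField K ι (m * l)) : ℂ) = (s x : ℂ)) →
    (∀ (m l : ℕ) (x : ringClassField K ι m) (x' : ringClassField K ι (m * l)),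
      (x : ℂ) = x' → (d (m * l)).emb x' = (d m).emb x) →
    (d 239).kolyvaginClass (p := 5) (by norm_num) 1 ≠ 0 →
    ((⟨0, 1, 1, 1, 6⟩ : WeierstrassCurve ℤ).map (Int.castRingHom ℚ)).shaCorank 5 = 0 ∧
      ((⟨0, 1, 1, 1, 6⟩ : WeierstrassCurve ℤ).map (Int.castRingHom ℚ)).mordellWeilRank = 2 ∧
      (((⟨0, 1, 1, 1, 6⟩ : WeierstrassCurve ℤ).map (Int.castRingHom ℚ)).quadraticTwist
        ((-8 : ℤ) : ℚ)).mordellWeilRank ≤ 1 ∧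
      (∀ P : ((⟨0, 1, 1, 1, 6⟩ : WeierstrassCurve ℤ).map (Int.castRingHom ℚ)).toAffine.Point,
        5 • P = 0 → P = 0) ∧
      (∀ x ∈ ((⟨0, 1, 1, 1, 6⟩ : WeierstrassCurve ℤ).map (Int.castRingHom ℚ)).sha, 5 • x = 0 → x = 0) ∧
      Nat.card ↥(selmerGroup ((⟨0, 1, 1, 1, 6⟩ : WeierstrassCurve ℤ).map (Int.castRingHom ℚ))
        ((5 : ℕ) : ℤ)) = 5 ^ 2 := by
  haveI := isElliptic_c817a1
  haveI := isGloballyMinimal_c817a1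
  haveI : NeZero (((⟨0, 1, 1, 1, 6⟩ : WeierstrassCurve ℤ).map (Int.castRingHom ℚ)).conductorNorm ℤ) :=
    neZero_conductorNorm_of_isElliptic _
  intro Dt β ι d hσ hS₁ hS₂ hemb hne
  haveI := Fact.mk (by norm_num : Nat.Prime 5)
  exact depthRow_noTwist_of_print_of_intModel_certificate intModel h54 h43 h44 h53 h22 not_hasCM
    KernelCertsR01.C817a1.two_le_rank 5 (by norm_num) hasSurjectiveModNGaloisRep_pow_5 K hK hD
    (by norm_num) (by norm_num) heegner_neg8 239 (by norm_num) (by norm_num) (by decide +kernel)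
    (by norm_num) (by norm_num) (by norm_num) (by norm_num) (n := 240) card_239 (by norm_num) Dt β ι
    d hσ hS₁ hS₂ hemb hne

end C817a1

namespace C997b1

/-- **DEPTH-TABLE ROW `997b1`, `(p, d_K, ℓ) = (5, -52, 199)`, without Kolyvagin's structure
theorem AND WITHOUT A POINT ON THE TWIST.** For `E = 997b1`, ANY imaginary quadratic `K` with
`d_K = -52`, any frame `(Dt, β, ι)` and any COMPATIBLE system `d n` of Kolyvagin–Heegner data over it
(`hσ`, `hS₁`, `hS₂`, `hemb`), granted the five named leaves (Gross Prop. 5.4 (2); McCallum Lemma 4.3,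
Prop. 4.4, Lemma 5.3, Prop. 2.2): IF the first derived class at the Kolyvagin prime `199` does not
vanish, `(d 199).kolyvaginClass _ 1 ≠ 0` (the row's bit), THEN `corank_{ℤ_5} Ш(E)[5^∞] = 0`,
`rank_ℤ E(ℚ) = 2`, `rank_ℤ E^{(-52)}(ℚ) ≤ 1`, `E(ℚ)[5] = 0`, `Ш(E/ℚ)[5] = 0` and `#Sel^(5)(E/ℚ) = 5²`
— the twin of `C997b1.depthRow_5_neg52_199_of_print` with its hypothesis `1 ≤ rank E^{(-52)}(ℚ)` DELETED
(kit `depthRow_noTwist_of_print_of_intModel_certificate`: Kolyvagin's eigen-bound read over `ℚ` through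
`Sel_5(E/ℚ) ↪ Sel_5(E/K)^+`). Every side condition is a kernel theorem of the tree. CONDITIONAL on the
five facts and the bit; per-curve; BSD is not proved by it. [cite: Kolyvagin1991MathAnn, Thm. 2.3]
[cite: McCallumLMS1991, §§2–5] [cite: GrossLMS1991, §5 (5.1)]
[cite: JetchevLauterStein2009, §3.6 (arXiv:0707.0032)] -/
theorem depthRow_5_neg52_199_noTwist
    (h54 : sign_conjAct_kolyvaginClass) (h43 : lemma43_kolyvaginClass_mem_selmerLocalKer)
    (h44 : prop44_localOrder_kolyvaginClass_mul_eq) (h53 : lemma53_selmer_eigen_dependent_at)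
    (h22 : prop22_reciprocity_eigen_finset)
    (K : Type) [Field K] [NumberField K] (hK : IsImaginaryQuadratic K)
    (hD : NumberField.discr K = -52) :
    haveI := isElliptic_c997b1;
    haveI := isGloballyMinimal_c997b1;
    haveI : NeZero (((⟨0, -1, 1, -5, -3⟩ : WeierstrassCurve ℤ).map (Int.castRingHom ℚ)).conductorNorm ℤ) :=
      neZero_conductorNorm_of_isElliptic _;
    ∀ (Dt : ModularParametrizationData ((⟨0, -1, 1, -5, -3⟩ : WeierstrassCurve ℤ).map (Int.castRingHom ℚ))
        (((⟨0, -1, 1, -5, -3⟩ : WeierstrassCurve ℤ).map (Int.castRingHom ℚ)).conductorNorm ℤ)) (β : ℤ)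
      (ι : K →+* ℂ) (d : ∀ m : ℕ, KolyvaginHeegnerData Dt β ι m),
    (∀ (m l : ℕ), ∀ l' ∈ m.primeFactors, ∀ (x : ringClassField K ι m)
      (x' : ringClassField K ι (m * l)),
      (x : ℂ) = x' → (((d (m * l)).σ l' x' : ringClassField K ι (m * l)) : ℂ) = ((d m).σ l' x : ℂ)) →
    (∀ (m l : ℕ), ∀ s ∈ (d m).S, ∃ s' ∈ (d (m * l)).S, ∀ (x : ringClassField K ι m)
      (x' : ringClassField K ι (m * l)),
      (x : ℂ) = x' → ((s' x' : ringClassField K ι (m * l)) : ℂ) = (s x : ℂ)) →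
    (∀ (m l : ℕ), ∀ s' ∈ (d (m * l)).S, ∃ s ∈ (d m).S, ∀ (x : ringClassField K ι m)
      (x' : ringClassField K ι (m * l)),
      (x : ℂ) = x' → ((s' x' : ringClassField K ι (m * l)) : ℂ) = (s x : ℂ)) →
    (∀ (m l : ℕ) (x : ringClassField K ι m) (x' : ringClassField K ι (m * l)),
      (x : ℂ) = x' → (d (m * l)).emb x' = (d m).emb x) →
    (d 199).kolyvaginClass (p := 5) (by norm_num) 1 ≠ 0 →
    ((⟨0, -1, 1, -5, -3⟩ : WeierstrassCurve ℤ).map (Int.castRingHom ℚ)).shaCorank 5 = 0 ∧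
      ((⟨0, -1, 1, -5, -3⟩ : WeierstrassCurve ℤ).map (Int.castRingHom ℚ)).mordellWeilRank = 2 ∧
      (((⟨0, -1, 1, -5, -3⟩ : WeierstrassCurve ℤ).map (Int.castRingHom ℚ)).quadraticTwist
        ((-52 : ℤ) : ℚ)).mordellWeilRank ≤ 1 ∧
      (∀ P : ((⟨0, -1, 1, -5, -3⟩ : WeierstrassCurve ℤ).map (Int.castRingHom ℚ)).toAffine.Point,
        5 • P = 0 → P = 0) ∧
      (∀ x ∈ ((⟨0, -1, 1, -5, -3⟩ : WeierstrassCurve ℤ).map (Int.castRingHom ℚ)).sha, 5 • x = 0 → x = 0) ∧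
      Nat.card ↥(selmerGroup ((⟨0, -1, 1, -5, -3⟩ : WeierstrassCurve ℤ).map (Int.castRingHom ℚ))
        ((5 : ℕ) : ℤ)) = 5 ^ 2 := by
  haveI := isElliptic_c997b1
  haveI := isGloballyMinimal_c997b1
  haveI : NeZero (((⟨0, -1, 1, -5, -3⟩ : WeierstrassCurve ℤ).map (Int.castRingHom ℚ)).conductorNorm ℤ) :=
    neZero_conductorNorm_of_isElliptic _
  intro Dt β ι d hσ hS₁ hS₂ hemb hne
  haveI := Fact.mk (by norm_num : Nat.Prime 5)
  exact depthRow_noTwist_of_print_of_intModel_certificate intModel h54 h43 h44 h53 h22 not_hasCM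
    KernelCertsR01.C997b1.two_le_rank 5 (by norm_num) hasSurjectiveModNGaloisRep_pow_5 K hK hD
    (by norm_num) (by norm_num) heegner_neg52 199 (by norm_num) (by norm_num) (by decide +kernel)
    (by norm_num) (by norm_num) (by norm_num) (by norm_num) (n := 205) card_199 (by norm_num) Dt β ι
    d hσ hS₁ hS₂ hemb hne

end C997b1

end Summit.BirchSwinnertonDyer.BirchSwinnertonDyer.Theorems.KolyvaginDepthDoor

end
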